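import Summits.ResolutionOfSingularities.ResolutionOfSingularities.Theorems.FrobeniusLadderFInjectiveMacaulayficationFiClauseOfRegular
import Mathlib.Algebra.CharP.Algebra
import Literature.AlgebraicGeometry.Resolution.QuasiExcellentSchemes
import HarnessLib

/-!
# Regular points are good points (crux `FInjectiveMacaulayfication`, hole #3: H10 strong ⇒ weak)

[OURS · L1 W4.5a] Support file for crux stmt-ResolutionOfSingularities-15315
(`Summit.ResolutionOfSingularities.ResolutionOfSingularities.Theses.FrobeniusLadder.FInjectiveMacaulayfication`, route
`FrobeniusLadder`, skeleton v11 `86e9127b5c98b8e6`), hole #3 = registered stub `stub_genericFInjectivization`.  The planner's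
hole-#3 interfaces v2 (`L/w45a/HoleThreeInterfaces2.lean`, CRUX-PLAN v4 §3.1) record two confined-step shapes — H10-STRONG (the
iso-locus contains every GOOD point off `closure {η}`) and H10-WEAK (it contains every REGULAR point off `closure {η}`) — and the
implication `StrongImpliesWeak p` as an UNPROVED statement, «a regular stalk satisfies the full clause … not yet a tree lemma at stalk
level in this bundled form».  This file supplies exactly that stalk-level lemma, so that `StrongImpliesWeak p` (for `p` prime) is a
three-line consequence (plug-tested against the planner's file by `exact`, see the STATUS line of this landing):

* `fiClause_stalk_of_isRegularLocalRing` — for `f : X ⟶ Spec k`, `char k = p` prime, and a point `x` with `𝒪_{X,x}` regular, the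
  FULL per-stalk clause of the crux holds at `x`: `𝒪_{X,x}` is a domain, every system of parameters is weakly regular and every
  parameter ideal is Frobenius closed (`FiClauseOfRegular.stub_fiClauseOfRegular`: Matsumura Thm. 17.4 + Kunz; the stalk has
  characteristic `p`: it receives a ring map from the field `k`, as in `Negative.charP_stalk`);
* `fiClause_of_mem_regularLocus` — the same from `x ∈ Scheme.regularLocus X`;
* `regularLocus_diff_subset` — the set-level form H10 uses: if an open (or any set) `U` contains every good point off `Z`, it
  contains `Scheme.regularLocus X ∖ Z`.

Folklore; no definition is declared; AI-written, weaker than expert review; no statement of [claim: Hironaka2017] is used.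
-/

-- single-problem summit: the doubled namespace component is forced
set_option linter.dupNamespace false

noncomputable section

open CategoryTheory AlgebraicGeometry
open Literature.AlgebraicGeometry.Resolution
open Summit.ResolutionOfSingularities.ResolutionOfSingularities.Theorems.FInjectiveMacaulayfication

namespace Summit.ResolutionOfSingularities.ResolutionOfSingularities.Theorems.FInjectiveMacaulayfication.RegularPointClause

/-- **A regular stalk satisfies the full clause.** For a scheme `X` over a field `k` of prime characteristic `p` and a point `x`
whose local ring is regular: `𝒪_{X,x}` is a domain, and for every system of parameters (`d = dim` elements generating an ideal
with maximal radical) the sequence is weakly regular and the ideal is Frobenius closed for the exponent base `p`.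
[cite: Matsumura1987, Thm. 17.4; Kunz1969, Thm. 2.1 (through `FiClauseOfRegular.stub_fiClauseOfRegular`)] -/
theorem fiClause_stalk_of_isRegularLocalRing (p : ℕ) [hp : Fact p.Prime] {k : Type} [Field k] [CharP k p]
    {X : Scheme.{0}} (f : X ⟶ Spec (.of k)) (x : X) (hx : IsRegularLocalRing (X.presheaf.stalk x)) :
    IsDomain (X.presheaf.stalk x) ∧
      ∀ d : ℕ, ringKrullDim (X.presheaf.stalk x) = d →
        ∀ s : Fin d → X.presheaf.stalk x, (Ideal.span (Set.range s)).radical.IsMaximal →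
          RingTheory.Sequence.IsWeaklyRegular (X.presheaf.stalk x) (List.ofFn s) ∧
          ∀ y : X.presheaf.stalk x, (∃ e : ℕ, y ^ p ^ e ∈ Ideal.span
            ((fun z : X.presheaf.stalk x => z ^ p ^ e) ''
              (Ideal.span (Set.range s) : Set (X.presheaf.stalk x)))) → y ∈ Ideal.span (Set.range s) := by
  haveI := hx
  -- adapted from `Negative.charP_stalk` (LoadBearing), restated to keep this file outside the route file's import cone
  haveI : CharP (X.presheaf.stalk x) p :=
    CharP.of_ringHom_of_ne_zero
      ((X.presheaf.germ ⊤ x trivial).hom.comp (f.appTop.hom.comp (Scheme.ΓSpecIso (.of k)).inv.hom)) p hp.out.ne_zero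
  exact FiClauseOfRegular.stub_fiClauseOfRegular p (X.presheaf.stalk x)

/-- The same from membership in the regular locus `Scheme.regularLocus X = {x | 𝒪_{X,x} regular}`. [folklore] -/
theorem fiClause_of_mem_regularLocus (p : ℕ) [Fact p.Prime] {k : Type} [Field k] [CharP k p]
    {X : Scheme.{0}} (f : X ⟶ Spec (.of k)) (x : X) (hx : x ∈ Scheme.regularLocus X) :
    IsDomain (X.presheaf.stalk x) ∧
      ∀ d : ℕ, ringKrullDim (X.presheaf.stalk x) = d →
        ∀ s : Fin d → X.presheaf.stalk x, (Ideal.span (Set.range s)).radical.IsMaximal →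
          RingTheory.Sequence.IsWeaklyRegular (X.presheaf.stalk x) (List.ofFn s) ∧
          ∀ y : X.presheaf.stalk x, (∃ e : ℕ, y ^ p ^ e ∈ Ideal.span
            ((fun z : X.presheaf.stalk x => z ^ p ^ e) ''
              (Ideal.span (Set.range s) : Set (X.presheaf.stalk x)))) → y ∈ Ideal.span (Set.range s) :=
  fiClause_stalk_of_isRegularLocalRing p f x hx

/-- **H10 strong ⇒ weak, set level.** If `U` contains every GOOD point (full clause at the stalk) outside `Z`, then it contains
every REGULAR point outside `Z`: `Scheme.regularLocus X ∖ Z ⊆ U`. [folklore] -/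
theorem regularLocus_diff_subset (p : ℕ) [Fact p.Prime] {k : Type} [Field k] [CharP k p]
    {X : Scheme.{0}} (f : X ⟶ Spec (.of k)) (U Z : Set X)
    (hU : ∀ y : X, (IsDomain (X.presheaf.stalk y) ∧
      ∀ d : ℕ, ringKrullDim (X.presheaf.stalk y) = d →
        ∀ s : Fin d → X.presheaf.stalk y, (Ideal.span (Set.range s)).radical.IsMaximal →
          RingTheory.Sequence.IsWeaklyRegular (X.presheaf.stalk y) (List.ofFn s) ∧
          ∀ w : X.presheaf.stalk y, (∃ e : ℕ, w ^ p ^ e ∈ Ideal.span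
            ((fun z : X.presheaf.stalk y => z ^ p ^ e) ''
              (Ideal.span (Set.range s) : Set (X.presheaf.stalk y)))) → w ∈ Ideal.span (Set.range s)) →
      y ∉ Z → y ∈ U) :
    Scheme.regularLocus X \ Z ⊆ U :=
  fun y hy => hU y (fiClause_of_mem_regularLocus p f y hy.1) hy.2

end Summit.ResolutionOfSingularities.ResolutionOfSingularities.Theorems.FInjectiveMacaulayfication.RegularPointClause

end
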